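import Summits.HodgeConjecture.HodgeCM.Model.ArchLineDatumTotal_1

/-! PORT of `HodgeCM/Model/ArchLineDatumTotal.lean` (HodgeCMPerL run 82) — part 2: continuation of `Summits.HodgeConjecture.HodgeCM.Model.ArchLineDatumTotal_1` (split at a top-level declaration boundary by port_pkg.py; scope re-opened below; declarations unchanged). -/

-- port_pkg: scope re-opened for this part (file-level context, then the namespace/section stack open at the cut)
set_option autoImplicit false
noncomputable section
open NumberField NumberField.InfinitePlace NumberField.mixedEmbedding IsDedekindDomain
open scoped Matrix Kronecker Classical TensorProduct ComplexConjugate SchwartzMap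
open MvPolynomial
open Literature.NumberTheory.Automorphic Literature.NumberTheory.Automorphic.UnitaryGroup Literature.NumberTheory.Weil1964
open Literature.RepresentationTheory.KonnoKonno2007 Literature.RepresentationTheory.KonnoKonno2007.RealDualPair
open Literature.NumberTheory.GelbartRogawski1991 Literature.NumberTheory.GelbartRogawski1991.UnitaryDualPair
open Literature.Analysis.SegalBargmann
open HodgeCM.Adelic HodgeCM.PerL34 HodgeCM.Model.HypCensus HodgeCM.Model.SupplyInstance
namespace HodgeCM.Model.ArchSideTerm
section Ctx

variable {L : CMField} {ι₁ : L →+* ℂ} (V : HermSpace3 L ι₁) {h : Bool} (c : SeesawCtx L)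
variable
  (hGR : (cmSplittingDatum (L : Type) finProdFinEquiv (frameD V) (frameD_real V) (frameD_ne V) (dW c.D) (dW_real c.D)
    (dW_ne c.D)).CompatibleSplitting)
  (hGR₀ : (cmSplittingDatum (L : Type) (e₁) (frameD V) (frameD_real V) (frameD_ne V) (lineVec (L : Type) (dW c.D 0))
    (fun _ => dW_real c.D 0) (fun _ => dW_ne c.D 0)).CompatibleSplitting)
  (hGR₁ : (cmSplittingDatum (L : Type) (e₁) (frameD V) (frameD_real V) (frameD_ne V) (lineVec (L : Type) (dW c.D 1))
    (fun _ => dW_real c.D 1) (fun _ => dW_ne c.D 1)).CompatibleSplitting)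
  (hGR₂ : (cmSplittingDatum (L : Type) (e₁) (frameD V) (frameD_real V) (frameD_ne V) (lineVec (L : Type) (dW' c.D 0))
    (fun _ => dW'_real c.D 0) (fun _ => dW'_ne c.D 0)).CompatibleSplitting)
  (hGR₃ : (cmSplittingDatum (L : Type) (e₁) (frameD V) (frameD_real V) (frameD_ne V) (lineVec (L : Type) (dW' c.D 1))
    (fun _ => dW'_real c.D 1) (fun _ => dW'_ne c.D 1)).CompatibleSplitting)
  (η : CMAdelic (L : Type) (frameD V) × CMAdelic (L : Type) (dW c.D) →* ℂˣ)
  (μ : Fin 4 → (InfinitePlace (L : Type) → ℤ))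

/-- **at a good context whose bit satisfies (F2)'s orientation Prop, the total datum's test functions are the degree-one vectors**
(those of (F2)'s `archLineDatumOfOrient`). -/
theorem archLineDatumTotal_Φinf_of_goodCtx (hc : SignRecipe.GoodCtx h ι₁ c)
    (hor : 0 < ((InfinitePlace.mk ι₁).embedding (imagUnit (L : Type))).im ↔ h = false) (hμ₀ hμ₁ hμ₂ hμ₃) :
    (archLineDatumTotal V c.D hGR hGR₀ hGR₁ hGR₂ hGR₃ η μ hμ₀ hμ₁ hμ₂ hμ₃).Φinf =
      linePhiVec V c.D (hpos₀_of_orient V c hc hor) (hpos₁_of_orient V c hc hor) (hpos₂_of_orient V c hc hor)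
        (hpos₃_of_orient V c hc hor) :=
  archLineDatumTotal_Φinf_of_pos _ _ _ _

/-- **at a good context whose bit VIOLATES the orientation Prop, every test function of the total datum is the vacuum.** -/
theorem archLineDatumTotal_Φinf_of_goodCtx_of_not_orient (hc : SignRecipe.GoodCtx h ι₁ c)
    (hnor : ¬ (0 < ((InfinitePlace.mk ι₁).embedding (imagUnit (L : Type))).im ↔ h = false)) (hμ₀ hμ₁ hμ₂ hμ₃) (k : Fin 4) :
    (archLineDatumTotal V c.D hGR hGR₀ hGR₁ hGR₂ hGR₃ η μ hμ₀ hμ₁ hμ₂ hμ₃).Φinf k =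
      ![vacPhi V (dW c.D 0) (dW_real c.D 0) (dW_ne c.D 0), vacPhi V (dW c.D 1) (dW_real c.D 1) (dW_ne c.D 1),
        vacPhi V (dW' c.D 0) (dW'_real c.D 0) (dW'_ne c.D 0), vacPhi V (dW' c.D 1) (dW'_real c.D 1) (dW'_ne c.D 1)] k := by
  have h0 := fun hp => hnor ((hpos_iff_orient_of_goodCtx V hc 0 (dW_real c.D 0)).1 hp)
  have h1 := fun hp => hnor ((hpos_iff_orient_of_goodCtx V hc 1 (dW_real c.D 1)).1 hp)
  have h2 := fun hp => hnor ((hpos_iff_orient_of_goodCtx V hc 2 (dW'_real c.D 0)).1 hp)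
  have h3 := fun hp => hnor ((hpos_iff_orient_of_goodCtx V hc 3 (dW'_real c.D 1)).1 hp)
  fin_cases k
  · exact linePhiT_of_not_pos h0
  · exact linePhiT_of_not_pos h1
  · exact linePhiT_of_not_pos h2
  · exact linePhiT_of_not_pos h3

end Ctx

end HodgeCM.Model.ArchSideTerm

end
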